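import Literature.Combinatorics.Sahi2008.MeasureMultilinear
import Literature.Combinatorics.Sahi2008.LebesgueBoxes
import HarnessLib

/-!
# Lieb–Sahi (2022), Lemma 2.2 at the measure level (layer cake) and Corollary 3.6 as printed

Topic `Literature/Combinatorics/Sahi2008` (sequel of `MeasureMultilinear.lean` — multilinearity of the
measure-level `E_n`, the cone lemma `msahiE_nonneg_of_cone`, bounded pointwise limits
`msahiE_nonneg_of_tendsto` — and of `LebesgueBoxes.lean` — Theorem 3.5 as printed, `liebSahi_thm35_volume`:
`E_n ≥ 0` for characteristic functions of `k`-rectangles under Lebesgue measure on `[0,1]^k`).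

## Source (read 2026-08-20 from the materialised arXiv text, corpus `paper:arxiv-2107.09838`, pp. 5, 8)

E. H. Lieb, S. Sahi, *On the extension of the FKG inequality to `n` functions*, J. Math. Phys. **63** (2022)
043301 = arXiv:2107.09838 [LiebSahi2021]:
> **Lemma 2.2** (proof). "Any positive `f` can be written as an integral over the characteristic functions of
> its upper level sets. Thus, `f(x) = ∫_0^∞ ξ_s(x) ds`, with `ξ_s(x) = 1` if `f(x) > s` and `0` otherwise. …
> Since `E_3` is multi-linear in `f,g,h`, this reduces Theorem 2.1 to the case of monotone characteristic
> functions."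
> §3.3: "By a rectangle in dimension `k`, or a `k`-rectangle, we mean a subset of `[0,1]^k` of the form
> `[0,r_1] × ⋯ × [0,r_k]`, `0 ≤ r_1,…,r_k ≤ 1`. … If `f` is the characteristic function of a rectangle, then
> any level set of `f` is either the same rectangle, or empty. However, using the layer-cake principle and
> multilinearlity as in the proof of Lemma 2.2 we obtain the following immediate extension of the previous
> result.
> **COROLLARY 3.6.** If `f^1,…,f^n` are positive, monotone functions whose level sets are (not necessarily
> homothetic) rectangles then `E_n(f^1,…,f^n) ≥ 0`."

## What is here (everything PROVED; no named facts; axioms standard)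

* `msahiE_nonneg_of_levelSets` — **the layer cake at the measure level** (the mechanism of Lemma 2.2, on any
  finite measure space): if `E_n ≥ 0` for all families of indicators of sets from a class `𝒮` of measurable
  sets, then `E_n(f^1,…,f^n) ≥ 0` for all nonnegative bounded `f^i` whose upper level sets `{f^i > t}`
  (`t ≥ 0`) belong to `𝒮` or are empty.  Proof as printed, made finitary: the quantisation
  `f_N = (1/N) Σ_{k < K} 1_{f > k/N}` (`= ⌈N f⌉/N`, a nonnegative combination of level-set indicators with
  `f ≤ f_N ≤ f + 1/N`) has `E_n ≥ 0` by multilinearity (`msahiE_nonneg_of_cone`), and `E_n(f_N) → E_n(f)`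
  (`msahiE_nonneg_of_tendsto`).
* `msahiE_nonneg_of_upperSets` — the instance "increasing measurable events ⟹ bounded increasing functions with
  measurable level sets" on a measurable preorder (Lemma 2.2's statement for a general measure).
* **`liebSahi_cor36` — Corollary 3.6 AS PRINTED**: Lebesgue measure on `[0,1]^k` (`κ → unitInterval`, `κ`
  finite), every `n`: if the `f^i` are nonnegative functions all of whose upper level sets `{f^i > t}`, `t ≥ 0`,
  are `k`-rectangles `[0,r_1] × ⋯ × [0,r_k]` or empty, then `E_n(f^1,…,f^n) ≥ 0` — from Theorem 3.5
  (`liebSahi_thm35_volume`) by the layer cake.  (Such functions are automatically decreasing and bounded by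
  their value at the origin, `apply_le_apply_bot_of_levelSets`; the printed hypothesis "monotone" is therefore
  not repeated, and "level sets are rectangles" is read as "upper level sets are rectangles or empty", the
  empty set occurring above the maximum.)

NOTHING here asserts Sahi's conjecture.
-/

noncomputable section

namespace Literature.Combinatorics.Sahi2008

open Finset Function MeasureTheory Filter Topology
open scoped unitInterval

variable {Ω : Type*} [MeasurableSpace Ω]

/-! ### The quantisation `⌈N f⌉ / N` as a finite layer cake -/

omit [MeasurableSpace Ω] in
/-- The number of levels `k < K` with `k/N < y` is `⌈N y⌉` (when `N y ≤ K`). [folklore] -/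
private theorem card_filter_level_lt {N K : ℕ} (hN : (0 : ℝ) < N) {y : ℝ} (hyK : (N : ℝ) * y ≤ K) :
    ((Finset.range K).filter fun k : ℕ => (k : ℝ) / N < y).card = ⌈(N : ℝ) * y⌉₊ := by
  have hset : (Finset.range K).filter (fun k : ℕ => (k : ℝ) / N < y) = Finset.range ⌈(N : ℝ) * y⌉₊ := by
    ext k
    simp only [Finset.mem_filter, Finset.mem_range, Nat.lt_ceil]
    constructor
    · rintro ⟨_, hk⟩
      rw [div_lt_iff₀ hN] at hk
      linarith
    · intro hk
      refine ⟨?_, ?_⟩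
      · exact_mod_cast (lt_of_lt_of_le hk hyK : (k : ℝ) < K)
      · rw [div_lt_iff₀ hN]
        linarith
  rw [hset, Finset.card_range]

omit [MeasurableSpace Ω] in
/-- **The quantisation is a layer cake**: `(1/N) Σ_{k<K} 1_{f > k/N}(x) = ⌈N f(x)⌉/N`, hence
`f(x) ≤ (1/N) Σ_{k<K} 1_{f > k/N}(x) ≤ f(x) + 1/N` (for `0 ≤ f(x)`, `N f(x) ≤ K`). [folklore] -/
private theorem quantise_bounds {N K : ℕ} (hN : (0 : ℝ) < N) {φ : Ω → ℝ} {x : Ω} (h0 : 0 ≤ φ x)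
    (hK : (N : ℝ) * φ x ≤ K) :
    φ x ≤ (∑ k ∈ Finset.range K, (1 / (N : ℝ)) * {z | (k : ℝ) / N < φ z}.indicator 1 x) ∧
      (∑ k ∈ Finset.range K, (1 / (N : ℝ)) * {z | (k : ℝ) / N < φ z}.indicator 1 x) ≤ φ x + 1 / N := by
  have hind : ∀ k : ℕ, ({z | (k : ℝ) / N < φ z} : Set Ω).indicator (1 : Ω → ℝ) x =
      if (k : ℝ) / N < φ x then 1 else 0 := fun k => by
    simp only [Set.indicator_apply, Set.mem_setOf_eq, Pi.one_apply]
  have hsum : (∑ k ∈ Finset.range K, (1 / (N : ℝ)) * {z | (k : ℝ) / N < φ z}.indicator 1 x) =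
      (⌈(N : ℝ) * φ x⌉₊ : ℝ) / N := by
    rw [← Finset.mul_sum]
    simp only [hind, Finset.sum_boole, card_filter_level_lt hN hK]
    rw [one_div, inv_mul_eq_div]
  rw [hsum]
  constructor
  · rw [le_div_iff₀ hN, mul_comm]
    exact Nat.le_ceil _
  · rw [div_le_iff₀ hN, add_mul, one_div, inv_mul_cancel₀ hN.ne', mul_comm (φ x)]
    have h := Nat.ceil_lt_add_one (mul_nonneg hN.le h0)
    exact h.le

/-! ### The layer cake at the measure level -/

/-- **Layer cake (Lieb–Sahi's Lemma 2.2, measure-level mechanism).**  On a finite measure space, let `𝒮` be a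
class of measurable sets such that `E_n(1_{A_1},…,1_{A_n}) ≥ 0` whenever every `A_i ∈ 𝒮`.  Then
`E_n(f^1,…,f^n) ≥ 0` for all nonnegative bounded `f^i` whose upper level sets `{f^i > t}`, `t ≥ 0`, lie in `𝒮`
or are empty: `f^i` is the bounded pointwise limit of the layer cakes `⌈N f^i⌉/N = (1/N) Σ_k 1_{f^i > k/N}`,
nonnegative combinations of such indicators, on which `E_n ≥ 0` by multilinearity.
[cite: LiebSahi2021, Lemma 2.2 (proof: layer cake and multilinearity)] -/
theorem msahiE_nonneg_of_levelSets (μ : Measure Ω) [IsFiniteMeasure μ] {n : ℕ} (𝒮 : Set (Set Ω))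
    (h𝒮m : ∀ A ∈ 𝒮, MeasurableSet A)
    (hE : ∀ A : Fin n → Set Ω, (∀ i, A i ∈ 𝒮) → 0 ≤ msahiE μ n fun i => (A i).indicator 1)
    (f : Fin n → Ω → ℝ) (hf0 : ∀ i x, 0 ≤ f i x) {B : ℝ} (hfB : ∀ i x, f i x ≤ B)
    (hlev : ∀ i (t : ℝ), 0 ≤ t → {x | t < f i x} ∈ 𝒮 ∨ {x | t < f i x} = ∅) :
    0 ≤ msahiE μ n f := by
  classical
  -- generators: the zero function and the indicators of members of `𝒮`
  set 𝒢 : Set (Ω → ℝ) := {g | g = 0 ∨ ∃ A ∈ 𝒮, g = A.indicator 1} with h𝒢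
  have h𝒢m : ∀ g ∈ 𝒢, Measurable g := by
    rintro g (rfl | ⟨A, hA, rfl⟩)
    · exact measurable_zero
    · exact measurable_one.indicator (h𝒮m A hA)
  have h𝒢D : ∀ g ∈ 𝒢, ∀ x, |g x| ≤ 1 := by
    rintro g (rfl | ⟨A, _, rfl⟩) x
    · simp
    · simp only [Set.indicator_apply, Pi.one_apply]
      split_ifs <;> simp
  have hE' : ∀ G : Fin n → Ω → ℝ, (∀ i, G i ∈ 𝒢) → 0 ≤ msahiE μ n G := by
    intro G hG
    by_cases hz : ∃ i, G i = 0
    · obtain ⟨i, hi⟩ := hz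
      exact le_of_eq (msahiE_eq_zero_of_slot_zero μ G hi).symm
    · push Not at hz
      have hGA : ∀ i, ∃ A ∈ 𝒮, G i = A.indicator 1 := fun i => (hG i).resolve_left (hz i)
      choose A hA hGA using hGA
      rw [show G = fun i => (A i).indicator 1 from funext hGA]
      exact hE A hA
  -- level-set indicators are generators
  have hgen : ∀ i (t : ℝ), 0 ≤ t → ({x | t < f i x} : Set Ω).indicator (1 : Ω → ℝ) ∈ 𝒢 := by
    intro i t ht
    rcases hlev i t ht with h | h
    · exact Or.inr ⟨_, h, rfl⟩
    · refine Or.inl ?_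
      rw [h, Set.indicator_empty]
      rfl
  -- the quantised families `⌈(N+1) f⌉/(N+1)`
  set F : ℕ → Fin n → Ω → ℝ := fun N i x =>
    ∑ k ∈ Finset.range ⌈((N : ℝ) + 1) * B⌉₊,
      (1 / ((N : ℝ) + 1)) * {z | (k : ℝ) / ((N : ℝ) + 1) < f i z}.indicator 1 x with hF
  have hN : ∀ N : ℕ, (0 : ℝ) < (N : ℝ) + 1 := fun N => by positivity
  have hNB : ∀ (N : ℕ) i x, ((N : ℝ) + 1) * f i x ≤ (⌈((N : ℝ) + 1) * B⌉₊ : ℕ) := fun N i x =>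
    (mul_le_mul_of_nonneg_left (hfB i x) (hN N).le).trans (Nat.le_ceil _)
  have hbounds : ∀ N i x, f i x ≤ F N i x ∧ F N i x ≤ f i x + 1 / ((N : ℝ) + 1) := by
    intro N i x
    have h := quantise_bounds (K := ⌈((N : ℝ) + 1) * B⌉₊) (φ := f i) (x := x) (N := N + 1)
      (by push_cast; exact hN N) (hf0 i x) (by push_cast; exact hNB N i x)
    push_cast at h
    exact h
  have hFpos : ∀ N, 0 ≤ msahiE μ n (F N) := fun N =>
    msahiE_nonneg_of_cone μ 𝒢 h𝒢m zero_le_one h𝒢D hE' (fun _ => Finset.range ⌈((N : ℝ) + 1) * B⌉₊)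
      (c := fun _ _ => 1 / ((N : ℝ) + 1)) (fun _ _ _ => (one_div_pos.2 (hN N)).le)
      (g := fun i k => {z | (k : ℝ) / ((N : ℝ) + 1) < f i z}.indicator 1)
      fun i k => hgen i _ (div_nonneg k.cast_nonneg (hN N).le)
  have hFm : ∀ N i, Measurable (F N i) := fun N i =>
    Finset.measurable_sum _ fun k _ =>
      (h𝒢m _ (hgen i _ (div_nonneg k.cast_nonneg (hN N).le))).const_mul _
  have hFC : ∀ N i x, |F N i x| ≤ |B| + 1 := by
    intro N i x
    obtain ⟨h1, h2⟩ := hbounds N i x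
    have h3 : 1 / ((N : ℝ) + 1) ≤ 1 := by
      rw [div_le_one (hN N)]
      linarith [(Nat.cast_nonneg N : (0 : ℝ) ≤ N)]
    rw [abs_le]
    constructor
    · linarith [hf0 i x, abs_nonneg B]
    · linarith [hfB i x, le_abs_self B]
  have hlim : ∀ i x, Tendsto (fun N => F N i x) atTop (𝓝 (f i x)) := by
    intro i x
    have hup : Tendsto (fun N : ℕ => f i x + 1 / ((N : ℝ) + 1)) atTop (𝓝 (f i x)) := by
      have h := (tendsto_one_div_add_atTop_nhds_zero_nat).const_add (f i x)
      rwa [add_zero] at h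
    exact tendsto_of_tendsto_of_tendsto_of_le_of_le tendsto_const_nhds hup (fun N => (hbounds N i x).1)
      fun N => (hbounds N i x).2
  exact msahiE_nonneg_of_tendsto μ F f hFm hFC hlim hFpos

/-- **Lemma 2.2 for a general measure, increasing-events form**: on a finite measure space carrying a preorder,
if `E_n(1_{U_1},…,1_{U_n}) ≥ 0` for all measurable up-sets `U_i`, then `E_n(f^1,…,f^n) ≥ 0` for all
nonnegative bounded increasing `f^i` with measurable upper level sets. [cite: LiebSahi2021, Lemma 2.2] -/
theorem msahiE_nonneg_of_upperSets [Preorder Ω] (μ : Measure Ω) [IsFiniteMeasure μ] {n : ℕ}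
    (hE : ∀ U : Fin n → Set Ω, (∀ i, IsUpperSet (U i)) → (∀ i, MeasurableSet (U i)) →
      0 ≤ msahiE μ n fun i => (U i).indicator 1)
    (f : Fin n → Ω → ℝ) (hf0 : ∀ i x, 0 ≤ f i x) {B : ℝ} (hfB : ∀ i x, f i x ≤ B)
    (hmono : ∀ i, Monotone (f i)) (hmeas : ∀ i (t : ℝ), MeasurableSet {x | t < f i x}) :
    0 ≤ msahiE μ n f := by
  refine msahiE_nonneg_of_levelSets μ {A | IsUpperSet A ∧ MeasurableSet A} (fun A hA => hA.2)
    (fun A hA => hE A (fun i => (hA i).1) fun i => (hA i).2) f hf0 hfB fun i t _ => Or.inl ⟨?_, hmeas i t⟩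
  intro x y hxy hx
  exact lt_of_lt_of_le hx (hmono i hxy)

/-! ### Corollary 3.6: functions with rectangular level sets, Lebesgue measure on `[0,1]^k` -/

namespace LebesgueBoxes

variable {κ : Type*}

/-- A `k`-rectangle is measurable (it is a product of intervals). [folklore] -/
private theorem measurableSet_rect [Finite κ] (r : κ → I) : MeasurableSet (rect r) := by
  have h : rect r = Set.pi Set.univ fun j => Set.Iic (r j) := by
    ext x
    simp only [rect, Set.mem_setOf_eq, Set.mem_pi, Set.mem_univ, true_implies, Set.mem_Iic]
  rw [h]
  exact MeasurableSet.pi Set.countable_univ fun j _ => measurableSet_Iic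

/-- **A function whose upper level sets are rectangles (or empty) is bounded by its value at the origin**
(the origin lies in every rectangle).  [cite: LiebSahi2021, §3.3 (k-rectangles) and Cor. 3.6] -/
theorem apply_le_apply_bot_of_levelSets {φ : (κ → I) → ℝ} (h0 : ∀ x, 0 ≤ φ x)
    (hlev : ∀ t : ℝ, 0 ≤ t → (∃ r, {x | t < φ x} = rect r) ∨ {x | t < φ x} = ∅) (x : κ → I) :
    φ x ≤ φ fun _ => 0 := by
  by_contra hlt
  push Not at hlt
  rcases hlev (φ fun _ => 0) (h0 _) with ⟨r, hr⟩ | hempty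
  · have hbot : (fun _ : κ => (0 : I)) ∈ rect r := fun j => (r j).2.1
    rw [← hr, Set.mem_setOf_eq] at hbot
    exact lt_irrefl _ hbot
  · have hx : x ∈ ({y | φ (fun _ => 0) < φ y} : Set (κ → I)) := hlt
    rw [hempty] at hx
    exact hx

/-- **A function whose upper level sets are rectangles (or empty) is decreasing** (rectangles are down-sets),
so the hypothesis "monotone" of Cor. 3.6 is automatic. [cite: LiebSahi2021, §3.3 (k-rectangles) and Cor. 3.6] -/
theorem antitone_of_levelSets {φ : (κ → I) → ℝ} (h0 : ∀ x, 0 ≤ φ x)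
    (hlev : ∀ t : ℝ, 0 ≤ t → (∃ r, {x | t < φ x} = rect r) ∨ {x | t < φ x} = ∅) : Antitone φ := by
  intro x y hxy
  by_contra hlt
  push Not at hlt
  -- `t = φ x ≥ 0`: `y` lies in the level set `{φ > t}`, a rectangle, hence so does `x ≤ y`
  rcases hlev (φ x) (h0 x) with ⟨r, hr⟩ | hempty
  · have hy : y ∈ rect r := by
      rw [← hr]
      exact hlt
    have hx : x ∈ rect r := fun j => (hxy j).trans (hy j)
    rw [← hr, Set.mem_setOf_eq] at hx
    exact lt_irrefl _ hx
  · have hy : y ∈ ({z | φ x < φ z} : Set (κ → I)) := hlt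
    rw [hempty] at hy
    exact hy

end LebesgueBoxes

open LebesgueBoxes in
/-- **Lieb–Sahi's Corollary 3.6, as printed**: for Lebesgue measure on `[0,1]^k` (`κ → unitInterval`, `κ`
finite) and every `n`, if `f^1,…,f^n` are nonnegative functions all of whose upper level sets `{f^i > t}`
(`t ≥ 0`) are `k`-rectangles `[0,r_1] × ⋯ × [0,r_k]` (or empty), then `E_n(f^1,…,f^n) ≥ 0`.  From Theorem 3.5
(`liebSahi_thm35_volume`) "using the layer-cake principle and multilinearity" (`msahiE_nonneg_of_levelSets`);
such `f^i` are decreasing and bounded (`antitone_of_levelSets`, `apply_le_apply_bot_of_levelSets`).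
[cite: LiebSahi2021, Cor. 3.6] -/
theorem liebSahi_cor36 {κ : Type*} [Fintype κ] (n : ℕ) (f : Fin n → (κ → I) → ℝ)
    (hf0 : ∀ i x, 0 ≤ f i x)
    (hlev : ∀ i (t : ℝ), 0 ≤ t → (∃ r, {x | t < f i x} = rect r) ∨ {x | t < f i x} = ∅) :
    0 ≤ msahiE (volume : Measure (κ → I)) n f := by
  classical
  refine msahiE_nonneg_of_levelSets volume (Set.range (rect (κ := κ))) ?_ ?_ f hf0
    (B := ∑ i, f i fun _ => 0) ?_ ?_
  · rintro A ⟨r, rfl⟩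
    exact measurableSet_rect r
  · intro A hA
    choose r hr using hA
    rw [show A = fun i => rect (r i) from funext fun i => (hr i).symm]
    exact liebSahi_thm35_volume n r
  · intro i x
    exact (apply_le_apply_bot_of_levelSets (hf0 i) (hlev i) x).trans
      (Finset.single_le_sum (f := fun j => f j fun _ => 0) (fun j _ => hf0 j _) (Finset.mem_univ i))
  · intro i t ht
    rcases hlev i t ht with ⟨r, hr⟩ | h
    · exact Or.inl ⟨r, hr.symm⟩
    · exact Or.inr h

/-! ### Slot-dependent classes (appended): cones and layer cakes slot by slot

For "mixed" statements — some slots ranging over one class of functions, the others over another (e.g.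
[Sahi2008, Thm. 2] / [Blinovsky2013] with free slots: cumulations in some slots, arbitrary increasing functions
in the others) — the cone lemma and the layer cake are needed with a class `𝒢 i` / `𝒮 i` depending on the slot
`i`.  The proofs are those of `msahiE_nonneg_of_cone` / `msahiE_nonneg_of_levelSets` verbatim. -/

/-- **Cone lemma, slot-dependent classes**: if `E_n ≥ 0` for every family with slot `i` drawn from a class `𝒢 i`
of measurable functions bounded by `D`, then `E_n ≥ 0` for every family whose slot `i` is a nonnegative finite
combination of members of `𝒢 i`. [cite: LiebSahi2021, Lemma 2.2 (proof) and Cor. 3.6 (proof); Sahi2008, p. 211] -/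
theorem msahiE_nonneg_of_cone_slotwise (μ : Measure Ω) [IsFiniteMeasure μ] {n : ℕ}
    (𝒢 : Fin n → Set (Ω → ℝ)) (h𝒢m : ∀ i, ∀ g ∈ 𝒢 i, Measurable g) {D : ℝ} (hD : 0 ≤ D)
    (h𝒢D : ∀ i, ∀ g ∈ 𝒢 i, ∀ x, |g x| ≤ D)
    (hE : ∀ G : Fin n → Ω → ℝ, (∀ i, G i ∈ 𝒢 i) → 0 ≤ msahiE μ n G)
    {ι : Type*} (s : Fin n → Finset ι) {c : Fin n → ι → ℝ} (hc : ∀ i, ∀ k ∈ s i, 0 ≤ c i k)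
    {g : Fin n → ι → Ω → ℝ} (hg : ∀ i k, g i k ∈ 𝒢 i) :
    0 ≤ msahiE μ n (fun i x => ∑ k ∈ s i, c i k * g i k x) := by
  classical
  set Φ : Fin n → Ω → ℝ := fun i x => ∑ k ∈ s i, c i k * g i k x with hΦ
  set B : ℝ := D + ∑ i, (∑ k ∈ s i, |c i k|) * D with hB
  have hBD : D ≤ B := by
    rw [hB]
    exact le_add_of_nonneg_right (Finset.sum_nonneg fun i _ =>
      mul_nonneg (Finset.sum_nonneg fun k _ => abs_nonneg _) hD)
  have hΦm : ∀ i, Measurable (Φ i) := fun i =>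
    Finset.measurable_sum (s i) fun k _ => (h𝒢m i _ (hg i k)).const_mul (c i k)
  have hΦB : ∀ i x, |Φ i x| ≤ B := by
    intro i x
    have h1 : |Φ i x| ≤ (∑ k ∈ s i, |c i k|) * D := by
      refine (Finset.abs_sum_le_sum_abs _ _).trans ?_
      rw [Finset.sum_mul]
      exact Finset.sum_le_sum fun k _ => by
        rw [abs_mul]
        exact mul_le_mul_of_nonneg_left (h𝒢D i _ (hg i k) x) (abs_nonneg _)
    refine h1.trans ?_
    rw [hB]
    have h2 : (∑ k ∈ s i, |c i k|) * D ≤ ∑ j, (∑ k ∈ s j, |c j k|) * D :=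
      Finset.single_le_sum (f := fun j => (∑ k ∈ s j, |c j k|) * D)
        (fun j _ => mul_nonneg (Finset.sum_nonneg fun k _ => abs_nonneg _) hD) (Finset.mem_univ i)
    linarith
  have key : ∀ (m : ℕ) (G : Fin n → Ω → ℝ), (∀ i, G i ∈ 𝒢 i) →
      0 ≤ msahiE μ n (fun i => if i.val < m then Φ i else G i) := by
    intro m
    induction m with
    | zero =>
      intro G hG
      simp only [Nat.not_lt_zero, if_false]
      exact hE G hG
    | succ m ih =>
      intro G hG
      by_cases hm : m < n
      · set i : Fin n := ⟨m, hm⟩ with hi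
        have hmix : (fun j : Fin n => if j.val < m + 1 then Φ j else G j) =
            update (fun j : Fin n => if j.val < m then Φ j else G j) i (Φ i) := by
          funext j
          by_cases hji : j = i
          · subst hji
            rw [update_self, if_pos (Nat.lt_succ_self m)]
          · rw [update_of_ne hji]
            have hjm : j.val ≠ m := fun h => hji (Fin.ext h)
            by_cases hlt : j.val < m
            · rw [if_pos hlt, if_pos (Nat.lt_succ_of_lt hlt)]
            · have : ¬ j.val < m + 1 := by omega
              rw [if_neg hlt, if_neg this]
        rw [hmix]
        have hFm : ∀ j, Measurable ((fun j : Fin n => if j.val < m then Φ j else G j) j) := by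
          intro j
          by_cases hlt : j.val < m
          · simp only [hlt, if_true]; exact hΦm j
          · simp only [hlt, if_false]; exact h𝒢m j _ (hG j)
        have hFB : ∀ j x, |(fun j : Fin n => if j.val < m then Φ j else G j) j x| ≤ B := by
          intro j x
          by_cases hlt : j.val < m
          · simp only [hlt, if_true]; exact hΦB j x
          · simp only [hlt, if_false]; exact (h𝒢D j _ (hG j) x).trans hBD
        refine msahiE_update_nonneg_of_finsetSum μ _ hFm hFB i (s i) (hc i) (fun k => h𝒢m i _ (hg i k))
          (fun k x => h𝒢D i _ (hg i k) x) fun k _ => ?_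
        have hupd : update (fun j : Fin n => if j.val < m then Φ j else G j) i (g i k) =
            fun j : Fin n => if j.val < m then Φ j else update G i (g i k) j := by
          funext j
          by_cases hji : j = i
          · subst hji
            have : ¬ (i.val < m) := lt_irrefl m
            rw [update_self, if_neg this, update_self]
          · rw [update_of_ne hji, update_of_ne hji]
        rw [hupd]
        refine ih (update G i (g i k)) fun j => ?_
        by_cases hji : j = i
        · subst hji; rw [update_self]; exact hg _ k
        · rw [update_of_ne hji]; exact hG j
      · have hmix : (fun j : Fin n => if j.val < m + 1 then Φ j else G j) =
            fun j : Fin n => if j.val < m then Φ j else G j := by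
          funext j
          have h1 : j.val < m := by omega
          rw [if_pos h1, if_pos (Nat.lt_succ_of_lt h1)]
        rw [hmix]
        exact ih G hG
  by_cases hι : Nonempty ι
  · obtain ⟨k₀⟩ := hι
    have h := key n (fun i => g i k₀) fun i => hg i k₀
    have hmix : (fun i : Fin n => if i.val < n then Φ i else g i k₀) = Φ := by
      funext i
      rw [if_pos i.isLt]
    rwa [hmix] at h
  · have hs : ∀ i, s i = ∅ := fun i =>
      Finset.eq_empty_of_forall_notMem fun k _ => hι ⟨k⟩
    cases n with
    | zero => rw [msahiE_zero]
    | succ n =>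
      refine le_of_eq (msahiE_eq_zero_of_slot_zero μ _ (i := 0) ?_).symm
      funext x
      show ∑ k ∈ s 0, c 0 k * g 0 k x = 0
      rw [hs 0, Finset.sum_empty]

/-- **Layer cake, slot-dependent classes**: on a finite measure space, let `𝒮 i` (`i < n`) be classes of
measurable sets with `E_n(1_{A_1},…,1_{A_n}) ≥ 0` whenever `A_i ∈ 𝒮 i` for every `i`.  Then
`E_n(f^1,…,f^n) ≥ 0` for all nonnegative bounded `f^i` whose upper level sets `{f^i > t}`, `t ≥ 0`, lie in
`𝒮 i` or are empty. [cite: LiebSahi2021, Lemma 2.2 (proof: layer cake and multilinearity)] -/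
theorem msahiE_nonneg_of_levelSets_slotwise (μ : Measure Ω) [IsFiniteMeasure μ] {n : ℕ}
    (𝒮 : Fin n → Set (Set Ω)) (h𝒮m : ∀ i, ∀ A ∈ 𝒮 i, MeasurableSet A)
    (hE : ∀ A : Fin n → Set Ω, (∀ i, A i ∈ 𝒮 i) → 0 ≤ msahiE μ n fun i => (A i).indicator 1)
    (f : Fin n → Ω → ℝ) (hf0 : ∀ i x, 0 ≤ f i x) {B : ℝ} (hfB : ∀ i x, f i x ≤ B)
    (hlev : ∀ i (t : ℝ), 0 ≤ t → {x | t < f i x} ∈ 𝒮 i ∨ {x | t < f i x} = ∅) :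
    0 ≤ msahiE μ n f := by
  classical
  set 𝒢 : Fin n → Set (Ω → ℝ) := fun i => {g | g = 0 ∨ ∃ A ∈ 𝒮 i, g = A.indicator 1} with h𝒢
  have h𝒢m : ∀ i, ∀ g ∈ 𝒢 i, Measurable g := by
    rintro i g (rfl | ⟨A, hA, rfl⟩)
    · exact measurable_zero
    · exact measurable_one.indicator (h𝒮m i A hA)
  have h𝒢D : ∀ i, ∀ g ∈ 𝒢 i, ∀ x, |g x| ≤ 1 := by
    rintro i g (rfl | ⟨A, _, rfl⟩) x
    · simp
    · simp only [Set.indicator_apply, Pi.one_apply]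
      split_ifs <;> simp
  have hE' : ∀ G : Fin n → Ω → ℝ, (∀ i, G i ∈ 𝒢 i) → 0 ≤ msahiE μ n G := by
    intro G hG
    by_cases hz : ∃ i, G i = 0
    · obtain ⟨i, hi⟩ := hz
      exact le_of_eq (msahiE_eq_zero_of_slot_zero μ G hi).symm
    · push Not at hz
      have hGA : ∀ i, ∃ A ∈ 𝒮 i, G i = A.indicator 1 := fun i => (hG i).resolve_left (hz i)
      choose A hA hGA using hGA
      rw [show G = fun i => (A i).indicator 1 from funext hGA]
      exact hE A hA
  have hgen : ∀ i (t : ℝ), 0 ≤ t → ({x | t < f i x} : Set Ω).indicator (1 : Ω → ℝ) ∈ 𝒢 i := by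
    intro i t ht
    rcases hlev i t ht with h | h
    · exact Or.inr ⟨_, h, rfl⟩
    · refine Or.inl ?_
      rw [h, Set.indicator_empty]
      rfl
  set F : ℕ → Fin n → Ω → ℝ := fun N i x =>
    ∑ k ∈ Finset.range ⌈((N : ℝ) + 1) * B⌉₊,
      (1 / ((N : ℝ) + 1)) * {z | (k : ℝ) / ((N : ℝ) + 1) < f i z}.indicator 1 x with hF
  have hN : ∀ N : ℕ, (0 : ℝ) < (N : ℝ) + 1 := fun N => by positivity
  have hNB : ∀ (N : ℕ) i x, ((N : ℝ) + 1) * f i x ≤ (⌈((N : ℝ) + 1) * B⌉₊ : ℕ) := fun N i x =>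
    (mul_le_mul_of_nonneg_left (hfB i x) (hN N).le).trans (Nat.le_ceil _)
  have hbounds : ∀ N i x, f i x ≤ F N i x ∧ F N i x ≤ f i x + 1 / ((N : ℝ) + 1) := by
    intro N i x
    have h := quantise_bounds (K := ⌈((N : ℝ) + 1) * B⌉₊) (φ := f i) (x := x) (N := N + 1)
      (by push_cast; exact hN N) (hf0 i x) (by push_cast; exact hNB N i x)
    push_cast at h
    exact h
  have hFpos : ∀ N, 0 ≤ msahiE μ n (F N) := fun N =>
    msahiE_nonneg_of_cone_slotwise μ 𝒢 h𝒢m zero_le_one h𝒢D hE'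
      (fun _ => Finset.range ⌈((N : ℝ) + 1) * B⌉₊)
      (c := fun _ _ => 1 / ((N : ℝ) + 1)) (fun _ _ _ => (one_div_pos.2 (hN N)).le)
      (g := fun i k => {z | (k : ℝ) / ((N : ℝ) + 1) < f i z}.indicator 1)
      fun i k => hgen i _ (div_nonneg k.cast_nonneg (hN N).le)
  have hFm : ∀ N i, Measurable (F N i) := fun N i =>
    Finset.measurable_sum _ fun k _ =>
      (h𝒢m i _ (hgen i _ (div_nonneg k.cast_nonneg (hN N).le))).const_mul _
  have hFC : ∀ N i x, |F N i x| ≤ |B| + 1 := by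
    intro N i x
    obtain ⟨h1, h2⟩ := hbounds N i x
    have h3 : 1 / ((N : ℝ) + 1) ≤ 1 := by
      rw [div_le_one (hN N)]
      linarith [(Nat.cast_nonneg N : (0 : ℝ) ≤ N)]
    rw [abs_le]
    constructor
    · linarith [hf0 i x, abs_nonneg B]
    · linarith [hfB i x, le_abs_self B]
  have hlim : ∀ i x, Tendsto (fun N => F N i x) atTop (𝓝 (f i x)) := by
    intro i x
    have hup : Tendsto (fun N : ℕ => f i x + 1 / ((N : ℝ) + 1)) atTop (𝓝 (f i x)) := by
      have h := (tendsto_one_div_add_atTop_nhds_zero_nat).const_add (f i x)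
      rwa [add_zero] at h
    exact tendsto_of_tendsto_of_tendsto_of_le_of_le tendsto_const_nhds hup (fun N => (hbounds N i x).1)
      fun N => (hbounds N i x).2
  exact msahiE_nonneg_of_tendsto μ F f hFm hFC hlim hFpos

end Literature.Combinatorics.Sahi2008
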